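import Summits.QuantumAdvantage.QuantumAdvantage.Theorems.CharDialShearDialA
import Summits.QuantumAdvantage.QuantumAdvantage.Theorems.CharDialSubCharJunta
import Summits.QuantumAdvantage.QuantumAdvantage.Theorems.CharDialRes5FrobGlue
import HarnessLib

/-!
# CharDial — THE SHEAR (part B): `TabAt p` at every odd prime; `FrobStructureLawOdd` (27205) and `FrobStructureLaw` (32603) HOLD

Tree twin, part B (§4–§5), of the decomp-qadv lens-5 g33 node `Theses/ShearDial.lean`; imports part A (the shear drops one degree,
`hasDegF_shear`).  ★★ `tabLaw_all` / `tabAt_all` (every odd prime, budget `p·J₀(p)` from the sub-characteristic junta law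
`SubChar.junta_of_hasDegF_subChar` + unit shifts `GammaDial.exch_union_of_unitShifts`), `tabOdd_holds`, law 2½ `lawAt_all`,
★★★ `frobStructureLawOdd_holds : Theses.CharDial.FrobStructureLawOdd` (BY NAME via `GammaDial.target_iff_tabOdd`), `p = 2` (`lawAt_two`) and
★★★ `frobStructureLaw_holds : Theses.CharDial.FrobStructureLaw`; upshot `frobHardOdd_of_residuals` / `frobHardOdd_of_walkHardFJLinOdd`
(parent crux 32598 from the JLin residuals alone, by the landed glue `TowerDefs.res5FrobGlue_holds`).  Kernel-checked, no `sorry`,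
no defs, no instances, no notation.  Lands `--kind proof --supports stmt-QuantumAdvantage-27205`.
-/

set_option autoImplicit false
set_option linter.dupNamespace false

namespace Summit.QuantumAdvantage.QuantumAdvantage.Theorems.ShearDial

open Finset
open Summit.QuantumAdvantage.AdviceFreeQNC0
open Literature.Computability.MetaComplexity Literature.Computability.MetaComplexity.Smolensky
open Summit.QuantumAdvantage.QuantumAdvantage.Theorems.IslandDial (Exch TopConst NormalForm ExchCoreAt ExchCoreOdd IslandAt IslandOdd
  exch_weight_form)
open Summit.QuantumAdvantage.QuantumAdvantage.Theorems.TableDial (TabLaw TabAt TabOdd SeedAt SeedOdd tabAt_iff_all)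
open Summit.QuantumAdvantage.QuantumAdvantage.Theorems.StrataDial (SwapInv exchCoreAt_iff_tabAt chi chi_eq_zero_of_card
  chi_eq_zero_of_not_subset moeb_slice seedAt_of_tabAt)
open Summit.QuantumAdvantage.QuantumAdvantage.Theorems.GammaDial (moeb_weight_top UnitShift swapInv_of_unitShift exch_union_of_unitShifts
  lawAt_of_tabAt islandAt_of_tabAt target_iff_tabOdd target_iff_exchCoreOdd)

/-! ### §4 THE TABLE LAW AT EVERY ODD PRIME — `TabAt p`, `TabOdd`, and item 27205 `FrobStructureLawOdd` BY NAME -/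

section Law

/-- ★★ **THE TABLE LAW, every odd prime, every `L`, budget `K = p·J₀(p)`** (`J₀(p)` the sub-characteristic junta bound at degree
`p − 2`).  Each sheared slice `g_z` of a class member is a `J₀(p)`-junta (§3 + tree `SubChar.junta_of_hasDegF_subChar`); a free coordinate
`k` read by NO `g_z` is a unit shift of the table (`g_z(x + e_k) = g_z(x)` for all `z` unfolds to `H(x + e_k, s) = H(x, s + 1)`), hence an
exchange partner of the block (tree `GammaDial.exch_union_of_unitShifts`): `Exch f (R ∪ (X ∖ R ∖ B))`, `B = ⋃_z J_z`, `|B| ≤ p·J₀(p)`. -/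
theorem tabLaw_all (p : ℕ) [hp : Fact p.Prime] (hp2 : p ≠ 2) : ∃ K : ℕ, ∀ L : ℕ, TabLaw p K L := by
  classical
  have hp3 : 3 ≤ p := by
    rcases Nat.lt_or_ge p 3 with h | h
    · exfalso
      have h2 := hp.out.two_le
      interval_cases p
      exact hp2 rfl
    · exact h
  obtain ⟨J₀, hJ₀⟩ := SubChar.junta_of_hasDegF_subChar p (p - 2) (by omega)
  refine ⟨p * J₀, fun L => ?_⟩
  intro n f X R hRX hR _hXL hdep hf htop hex
  obtain ⟨γ, _hγ, hγt⟩ := htop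
  obtain ⟨H, hH⟩ := exch_weight_form p f R hf hR hex
  have hJ : ∀ z : ZMod p, ∃ J : Finset (Fin n), J.card ≤ J₀ ∧
      ∀ u v : Fin n → Bool, (∀ i ∈ J, u i = v i) → shear X R H z u = shear X R H z v :=
    fun z => hJ₀ n (shear X R H z) (hasDegF_shear hp2 hRX hR hdep hf hγt hH z)
  choose J hJc hJdep using hJ
  obtain ⟨B, hBdef⟩ : ∃ B : Finset (Fin n), B = Finset.univ.biUnion J := ⟨_, rfl⟩
  -- free coordinates off `B` are unit shifts of the table
  have hshift : ∀ k ∈ (X \ R) \ B, k ∉ R ∧ UnitShift R H k := by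
    intro k hk
    have hkXR : k ∈ X \ R := (Finset.mem_sdiff.1 hk).1
    have hkB : k ∉ B := (Finset.mem_sdiff.1 hk).2
    have hkR : k ∉ R := (Finset.mem_sdiff.1 hkXR).2
    have hkJ : ∀ z, k ∉ J z := fun z hkz => hkB (by rw [hBdef]; exact Finset.mem_biUnion.2 ⟨z, Finset.mem_univ _, hkz⟩)
    refine ⟨hkR, fun x hxk s => ?_⟩
    have e := hJdep (s + 1 + ((SubChar.bw (X \ R) x : ℕ) : ZMod p)) (Function.update x k true) x
      (fun i hi => Function.update_of_ne (fun h => hkJ _ (h ▸ hi)) _ _)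
    unfold shear at e
    rw [bw_update_true hkXR hxk, Nat.cast_add, Nat.cast_one] at e
    have e1 : s + 1 + ((SubChar.bw (X \ R) x : ℕ) : ZMod p) - (((SubChar.bw (X \ R) x : ℕ) : ZMod p) + 1) = s := by ring
    have e2 : s + 1 + ((SubChar.bw (X \ R) x : ℕ) : ZMod p) - ((SubChar.bw (X \ R) x : ℕ) : ZMod p) = s + 1 := by ring
    rw [e1, e2] at e
    exact e
  have hRne : R.Nonempty := by
    rw [← Finset.card_pos]
    omega
  refine ⟨R ∪ ((X \ R) \ B), ?_, ?_, exch_union_of_unitShifts hH hex hRne hshift⟩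
  · exact Finset.union_subset hRX fun k hk => (Finset.mem_sdiff.1 (Finset.mem_sdiff.1 hk).1).1
  · have hBc : B.card ≤ p * J₀ := by
      rw [hBdef]
      calc (Finset.univ.biUnion J).card ≤ ∑ z, (J z).card := Finset.card_biUnion_le
        _ ≤ ∑ _z : ZMod p, J₀ := Finset.sum_le_sum fun z _ => hJc z
        _ = p * J₀ := by rw [Finset.sum_const, Finset.card_univ, ZMod.card, smul_eq_mul]
    have hXsub : X ⊆ (R ∪ ((X \ R) \ B)) ∪ B := by
      intro k hk
      by_cases hkR : k ∈ R
      · exact Finset.mem_union_left _ (Finset.mem_union_left _ hkR)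
      · by_cases hkB : k ∈ B
        · exact Finset.mem_union_right _ hkB
        · exact Finset.mem_union_left _ (Finset.mem_union_right _
            (Finset.mem_sdiff.2 ⟨Finset.mem_sdiff.2 ⟨hk, hkR⟩, hkB⟩))
    calc X.card ≤ ((R ∪ ((X \ R) \ B)) ∪ B).card := Finset.card_le_card hXsub
      _ ≤ (R ∪ ((X \ R) \ B)).card + B.card := Finset.card_union_le _ _
      _ ≤ (R ∪ ((X \ R) \ B)).card + p * J₀ := by omega

/-- ★★ **`TabAt p` at every odd prime.** -/
theorem tabAt_all (p : ℕ) [Fact p.Prime] (hp2 : p ≠ 2) : TabAt p :=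
  (tabAt_iff_all p).2 (tabLaw_all p hp2)

/-- `TabOdd` — the residual of g31/g32 (`target_iff_tabOdd`) — HOLDS. -/
theorem tabOdd_holds : TabOdd := fun p _ hp5 => tabAt_all p (by omega)

/-- The exchangeable core (piece E of g28) at every odd prime … -/
theorem exchCoreAt_all (p : ℕ) [Fact p.Prime] (hp2 : p ≠ 2) : ExchCoreAt p :=
  (exchCoreAt_iff_tabAt p).2 (tabAt_all p hp2)

/-- … hence `ExchCoreOdd` … -/
theorem exchCoreOdd_holds : ExchCoreOdd := fun p _ hp5 => exchCoreAt_all p (by omega)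

/-- … the island law (piece I of g28) at every odd prime, and `IslandOdd` … -/
theorem islandAt_all (p : ℕ) [Fact p.Prime] (hp2 : p ≠ 2) : IslandAt p := islandAt_of_tabAt p (tabAt_all p hp2)

/-- `IslandOdd` (piece I of g28 for all `p ≥ 5`) HOLDS. -/
theorem islandOdd_holds : IslandOdd := fun p _ hp5 => islandAt_all p (by omega)

/-- … and the seed (g30) at every odd prime, and `SeedOdd`. -/
theorem seedAt_all (p : ℕ) [Fact p.Prime] (hp2 : p ≠ 2) : SeedAt p := seedAt_of_tabAt (tabAt_all p hp2)

/-- `SeedOdd` (the g30 seed for all `p ≥ 5`) HOLDS. -/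
theorem seedOdd_holds : SeedOdd := fun p _ hp5 => seedAt_all p (by omega)

/-- ★★ **LAW 2½ AT EVERY ODD PRIME** (also `p = 3`): every Boolean function of `𝔽_p`-degree `≤ p − 1` is a junta ⊕ ONE linear form,
`f u = h(u|_J, Σᵢ [uᵢ] aᵢ)` with `|J| ≤ J₀(p)` (tree `GammaDial.lawAt_of_tabAt`). -/
theorem lawAt_all (p : ℕ) [Fact p.Prime] (hp2 : p ≠ 2) :
    ∃ J₀ : ℕ, ∀ (n : ℕ) (f : (Fin n → Bool) → Bool), HasDegF p f (p - 1) → NormalForm p f J₀ :=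
  lawAt_of_tabAt p (tabAt_all p hp2)

/-- ★★★ **ITEM stmt-QuantumAdvantage-27205 DECIDED**: the route statement `CharDial.FrobStructureLawOdd` HOLDS (BY NAME, via the tree's
`GammaDial.target_iff_tabOdd` and `tabOdd_holds`). -/
theorem frobStructureLawOdd_holds : Summit.QuantumAdvantage.QuantumAdvantage.Theses.CharDial.FrobStructureLawOdd :=
  target_iff_tabOdd.2 tabOdd_holds

/-- UPSHOT FOR THE PARENT CRUX `FrobHardOdd` (stmt-QuantumAdvantage-32598): with the structure-law binder of the LANDED glue
`Res5FrobGlue` (tree `TowerDefs.res5FrobGlue_holds`) discharged, the Frobenius notch follows from the two JLin residuals ALONE … -/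
theorem frobHardOdd_of_residuals
    (hlow : Summit.QuantumAdvantage.QuantumAdvantage.Theses.CharDial.JLinLowResidual5)
    (hhigh : Summit.QuantumAdvantage.QuantumAdvantage.Theses.CharDial.JLinResidualHigh5) :
    Summit.QuantumAdvantage.QuantumAdvantage.Theses.CharDial.FrobHardOdd :=
  JLinPeel.TowerDefs.res5FrobGlue_holds frobStructureLawOdd_holds hlow hhigh

/-- … equivalently from the route's aside `WalkHardFJLinOdd` (stmt-QuantumAdvantage-32604) alone: the route's own bridge
«structure law ∧ JLin hardness ⟹ Frobenius-notch hardness» has its first conjunct PROVED. -/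
theorem frobHardOdd_of_walkHardFJLinOdd (h : Summit.QuantumAdvantage.QuantumAdvantage.Theses.CharDial.WalkHardFJLinOdd) :
    Summit.QuantumAdvantage.QuantumAdvantage.Theses.CharDial.FrobHardOdd :=
  frobHardOdd_of_residuals (JLinPeel.TowerDefs.res5Split_of_walkHardFJLinOdd h).1
    (JLinPeel.TowerDefs.res5Split_of_walkHardFJLinOdd h).2

end Law

/-! ### §5 `p = 2` (degree `≤ 1` over `𝔽₂` = affine) and the route's aside `FrobStructureLaw` (32603) at EVERY prime -/

section Two

/-- A function of degree `≤ 1` on the cube is affine: `g(u) = c + Σᵢ [uᵢ] aᵢ` (span induction over the monomials `1`, `xᵢ`). -/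
theorem affine_of_mem_lowDeg_one {F : Type*} [Field F] {n : ℕ} {g : CubeFn F n} (hg : g ∈ lowDeg F n 1) :
    ∃ c : F, ∃ a : Fin n → F, ∀ u, g u = c + ∑ i, (if u i then a i else 0) := by
  classical
  rw [lowDeg_eq_span] at hg
  induction hg using Submodule.span_induction with
  | mem x hx =>
    obtain ⟨⟨S, hS⟩, rfl⟩ := hx
    rcases Nat.le_one_iff_eq_zero_or_eq_one.1 hS with h0 | h1
    · rw [Finset.card_eq_zero] at h0
      refine ⟨1, fun _ => 0, fun u => ?_⟩
      simp [h0]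
    · obtain ⟨i, hi⟩ := Finset.card_eq_one.1 h1
      refine ⟨0, fun j => if j = i then 1 else 0, fun u => ?_⟩
      show mono F S u = _
      rw [hi, mono_apply, zero_add, Finset.sum_eq_single i (fun j _ hj => by simp [hj]) (fun h => absurd (Finset.mem_univ i) h)]
      simp
  | zero => exact ⟨0, fun _ => 0, fun u => by simp⟩
  | add x y _ _ hx hy =>
    obtain ⟨c₁, a₁, h₁⟩ := hx
    obtain ⟨c₂, a₂, h₂⟩ := hy
    refine ⟨c₁ + c₂, fun i => a₁ i + a₂ i, fun u => ?_⟩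
    rw [Pi.add_apply, h₁ u, h₂ u]
    have e : ∑ i, (if u i then a₁ i + a₂ i else 0) = ∑ i, (if u i then a₁ i else 0) + ∑ i, (if u i then a₂ i else 0) := by
      rw [← Finset.sum_add_distrib]
      refine Finset.sum_congr rfl fun i _ => ?_
      split_ifs <;> simp
    rw [e]
    ring
  | smul r x _ hx =>
    obtain ⟨c, a, h⟩ := hx
    refine ⟨r * c, fun i => r * a i, fun u => ?_⟩
    rw [Pi.smul_apply, h u, smul_eq_mul, mul_add, Finset.mul_sum]
    congr 1
    refine Finset.sum_congr rfl fun i _ => ?_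
    split_ifs <;> simp

/-- LAW 2½ AT `p = 2`: a Boolean function of `𝔽₂`-degree `≤ 1` is affine, i.e. a function of ONE linear form (empty junta). -/
theorem lawAt_two (n : ℕ) (f : (Fin n → Bool) → Bool) (hf : HasDegF 2 f 1) : NormalForm 2 f 0 := by
  classical
  obtain ⟨c, a, hca⟩ := affine_of_mem_lowDeg_one ((SubLog.hasDegF_iff_indR 2 f 1).1 hf)
  refine ⟨∅, le_rfl, a, fun _ s => decide (c + s = 1), fun _ _ _ _ => rfl, fun u => ?_⟩
  have hu := hca u
  unfold SubLog.indR at hu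
  have h01 : (0 : ZMod 2) ≠ 1 := by decide
  show f u = decide (c + ∑ i, (if u i then a i else 0) = 1)
  rw [← hu]
  cases f u <;> simp [h01]

/-- ★★ **LAW 2½ AT EVERY PRIME** — the route's aside `CharDial.FrobStructureLaw` (stmt-QuantumAdvantage-32603) HOLDS: `p = 2` by
`lawAt_two` (`J₀ = 0`), odd `p` by `lawAt_all`. -/
theorem frobStructureLaw_holds : Summit.QuantumAdvantage.QuantumAdvantage.Theses.CharDial.FrobStructureLaw := by
  intro p _
  by_cases hp2 : p = 2
  · subst hp2
    exact ⟨0, fun n f hf => lawAt_two n f hf⟩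
  · exact lawAt_all p hp2

end Two

end Summit.QuantumAdvantage.QuantumAdvantage.Theorems.ShearDial
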